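import Summits.QuantumFields.BalabanUV.Beta.GAN24.SymContactBorderEntryBoundMf
import Summits.QuantumFields.BalabanUV.Beta.GAN24.BornBorderContactLineage

/-!
# `BalabanUV.Beta.GAN24.CombBornBorderContactLineage` — row G-an2-4 ∕ (CONV-C), TRANSFER-III, the (III′) S-slot (b), born-V contact letter `hCv` of road-P2 M.104, LEG HALF (V-C2′)
# of the OWNER's memo `HCV-DESIGN-g55.md`: **THE WEIGHTED CONTACT ENTRY OF ONE (III′) V LINEAGE** (`d = 3`) — leaf-03 g55's (E) (C2) `BornBorderContactLineage.abs_weight_mul_contact_v_le_three`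
# re-run with the CONJUGATED chain `T″_i = legChain (j ↦ legComp ψ♭_r (respStepBmSeq ρ_l Lc j)) i n` (pure-gauge law road-P2 M.59 `combLegChain_sub_respStep`, gauge `λ′ = Ψ + PsiFace − bmGauge`
# as a staircase of the legs' own depth — the OWNER's `CombContactGaugeStaircaseMerged.exists_combGauge_staircase_merged`, letter `A·C₁·X⁻¹`, `A = (8Lc + F(1+8Lc(e^{κ₁}+1)))(1+Lc)`),
# the table an1's SYMMETRISED border `cVH • symVhSAt ρ_t` (cells (B2′)(B3′) `SymContactBorderEntryBound(Mf)`), three independent in-block roots `r` (corrector) ∕ `rl` (dressing) ∕ `rt` (table)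
# (OWNER `b2b-balaban-gan24-p1` gen 55)

NOT IN PRINT — OUR PROOF ATTEMPT of the (III′) V analogue of the count BORNSEC-PLAN v1.1 §0 (c) for ONE lineage ([folklore] bookkeeping; the (E) proof token for token except: the
gauge plumbing (M.59 + the merged staircase instead of leaf-01's `gauge_eq_staircase ∕ abs_gaugePiece_le`), the cell polynomial (`polyV_le` for the letter `A·C₁·X⁻¹` instead of leaf-02's
`polyS_le` at `A = 8Lc`), and an1's `(d+1)!` normalisations carried in the constant; every other step — leaf-02's `units_le`, leaf-03's `exp_recenter_*`, `isFF_push₃`, `push₃_reslot_smul` —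
BY NAME).  0 `def`, 0 cited fact, 0 `def … : Prop`, 0 sorry; NO estimate of Bałaban's is discharged here — the letters ((N1), the conjugated envelope, the two multiplier-leg tents) are
HYPOTHESES; (V-D′) `CombBornBorderContactBound` discharges them.
HONEST FRAMING (cell contract, verbatim): «discharging `BetaPertH` makes Bałaban's UV stability UNCONDITIONAL — a real constructive-QFT result; it is NOT the continuum limit
and NOT the Clay problem.»  HONEST DEPENDENCY (verbatim): «continuum YM on T⁴ ⇐ BetaPertH ∧ nine spine estimates (0/9 proved); BetaPertH ⇐ (D1) ∧ (D4) ∧ CAP+tail; G-an2-4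
gates asym, D1 and NE2/3/4.»  This file discharges nothing: NOT `hCv`, NOT (hS, hSall), NEVER «G-an2-4 closed» as (CONV-C); NOT D1, NOT BetaPertH, NOT continuum, NOT Clay.
2026-08-28; no existing file touched.

## What is proved
* §1 `polyV_le` — the border cell polynomial `2K_B(2α_g + 2α_g·Lc·n) + (4α_g² + 8α_g²·Lc·n)` at `K_B = C₁X⁻¹`, `α_g = A·C₁X⁻¹` is `≤ C₁²·X⁻²·(n+1)·(4A + 4A² + 4A·Lc + 8A²·Lc)` (`A, Lc, n ≥ 0`).
* §2 **`abs_weight_mul_comb_contact_v_le_three`** (`2 ≤ Lc`, roots `r rl rt ∈ box`, `faceWtSum r Lc ≤ F`, `|cE| ≤ Lc^4`; letters as in (C2) with the conjugated envelope `K_E, κ_E` of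
  `T″_i`): for ALL `κ′ u′ x z a b`,
  `|(cE·Lc^8)^{n+1}·(((push₃ (−T″_i) M T″_i S − push₃ (−B_i) M B_i S) + (push₃ M′ T″_i T″_i S′ − push₃ M′ B_i B_i S′)) κ′ u′ x z a b)| ≤ |cVH|·C_fin·((n+1)·(Lc⁻¹)^{n+1})·e^{−(κ∕96)(|x−u′|₁ + |z−u′|₁)}`,
  `S = reslot inl inr (cVH • symVhSAt ρ_t)`, `S′ = reslot inr inl (…)`, `κ = min δ_K κ₁`,
  `C_fin = 2·Lc^3·((4!·Lc^4)⁻¹·(4·T_b·(e^{8κ})²·Cnt_sym)·(C₁²·(4A + 4A² + 4A·Lc + 8A²·Lc))·Zl 4 (κ∕16))`, `Cnt_sym = (2Lc)^4·(4·(4!·(Lc^4·ℓ)))` — the summand shape of the RIGHT side of the OWNER's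
  `CombBornBorderContactNest.combContact_v_eq_of_succ ∕ _of_top` (legs at `r = rl = ctrOff`, any sym record `tabs.V = symVhSAt ρ_t`).
-/

noncomputable section

open scoped BigOperators
open Literature.MathematicalPhysics.QuantumFieldTheory
open Literature.MathematicalPhysics.QuantumFieldTheory.LatticeForm (quo)
open Literature.MathematicalPhysics.QuantumFieldTheory.Balaban1983to89
open Literature.MathematicalPhysics.QuantumFieldTheory.Balaban1983to89.Beta
open B4ContourShift (supNorm supNorm_nonneg exists_supNorm_eq abs_le_supNorm)
open B4TorusKernel (supNorm_neg)
open B12Sec2to5 (l1 l1_nonneg)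
open ExpKernelCalculus (MKer Zl Zl_nonneg)
open AffineAveraging (Form0 Form1 Site box toSite unitVec dz)
open AveragingContours (blk)
open AveragingHessianKernels (ell)
open Summit.QuantumFields.BalabanUV.Beta.SymAveragingHessianCounts (symVhSAt)
open OneStepResolventKernel (Fib)
open KKTFluctuationKernel (delta1)
open BalabanCompositeJets (respStep)
open Summit.QuantumFields.BalabanUV.Beta.AxialProjectorBlockMean (bmGaugeAt)
open Summit.QuantumFields.BalabanUV.Beta.GAN24.RespStepBmDecompLegs (legAct)
open Summit.QuantumFields.BalabanUV.Beta.GAN24.RespStepBmDecompPsi (Psi)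
open Summit.QuantumFields.BalabanUV.Beta.GAN24.RespStepBmDecompExact (respStepBmSeq)
open Summit.QuantumFields.BalabanUV.Beta.GAN24.Push4Iter (legChain)
open Summit.QuantumFields.BalabanUV.Beta.GAN24.Push3 (push₃ isFF_push₃)
open Summit.QuantumFields.BalabanUV.Beta.GAN24.Push3LegTelescope (push₃_neg_left abs_le_of_env' summable_of_env')
open Summit.QuantumFields.BalabanUV.Beta.GAN24.SrecLinearPartEq (reslot)
open Summit.QuantumFields.BalabanUV.Beta.GAN24.ContactLambdaCellBound (exp_env_mono_rate exp_supNorm_add_le_exp_l1)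
open Summit.QuantumFields.BalabanUV.Beta.GAN24.ContactBorderCommutator (push₃_reslot_smul)
open Summit.QuantumFields.BalabanUV.Beta.GAN24.SymContactBorderEntryBound (abs_contact_border_fm_le)
open Summit.QuantumFields.BalabanUV.Beta.GAN24.SymContactBorderEntryBoundMf (abs_contact_border_mf_le)
open Summit.QuantumFields.BalabanUV.Beta.GAN24.BornLambdaContactLineage (units_le)
open Summit.QuantumFields.BalabanUV.Beta.GAN24.BornBorderContactLineage (exp_recenter_right_le exp_recenter_left_le)

namespace Summit.QuantumFields.BalabanUV.Beta.GAN24.CombBornBorderContactLineage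

/-! ## §1 The border cell polynomial for the gauge letter `A·C₁·X⁻¹` -/

/-- [folklore] **THE BORDER CELL POLYNOMIAL AT THE MERGED GAUGE LETTER**: with `K_B = C₁X⁻¹` and `α_g = A·C₁X⁻¹` (`A ≥ 0`),
`2K_B(2α_g + 2α_g·Lc·n) + (4α_g² + 2·(4α_g²)·Lc·n) ≤ C₁²·(X⁻¹)²·((n+1)·(4A + 4A² + 4A·Lc + 8A²·Lc))` — the (B2)∕(B3) polynomial, counted as leaf-02's `polyS_le` counts the Λ one. -/
theorem polyV_le {Lc : ℕ} {C₁ X A : ℝ} (hX : 0 < X) (hA : 0 ≤ A) (n : ℕ) :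
    2 * (C₁ * X⁻¹) * (2 * (A * C₁ * X⁻¹) + 2 * (A * C₁ * X⁻¹) * Lc * n)
        + (4 * (A * C₁ * X⁻¹) ^ 2 + 2 * (4 * (A * C₁ * X⁻¹) ^ 2) * Lc * n)
      ≤ C₁ ^ 2 * (X⁻¹) ^ 2 * (((n : ℝ) + 1) * (4 * A + 4 * A ^ 2 + 4 * A * Lc + 8 * A ^ 2 * Lc)) := by
  have hL : (0 : ℝ) ≤ (Lc : ℝ) := Nat.cast_nonneg _
  have hn : (0 : ℝ) ≤ n := Nat.cast_nonneg _
  have hB : 0 ≤ C₁ ^ 2 * (X⁻¹) ^ 2 := by positivity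
  have e : 2 * (C₁ * X⁻¹) * (2 * (A * C₁ * X⁻¹) + 2 * (A * C₁ * X⁻¹) * Lc * n)
        + (4 * (A * C₁ * X⁻¹) ^ 2 + 2 * (4 * (A * C₁ * X⁻¹) ^ 2) * Lc * n)
      = C₁ ^ 2 * (X⁻¹) ^ 2 * (4 * A + 4 * A ^ 2 + (4 * A * Lc + 8 * A ^ 2 * Lc) * n) := by ring
  rw [e]
  refine mul_le_mul_of_nonneg_left ?_ hB
  have h1 : 0 ≤ 4 * A + 4 * A ^ 2 := by positivity
  have h2 : 0 ≤ 4 * A * Lc + 8 * A ^ 2 * Lc := by positivity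
  nlinarith [mul_nonneg h1 hn, mul_nonneg h2 hn]

/-! ## §2 The weighted contact entry of one (III′) V lineage -/

section Lineage

variable {Lc : ℕ} [NeZero Lc]
variable {rt : Fin (3 + 1) → ℕ} {i n : ℕ} {cE cVH : ℝ} {C₁ κ₁ KE κE CM' Tb δK A : ℝ}
  {T : Fin (3 + 1) → (Fin (3 + 1) → ℤ) → Fin (3 + 1) → (Fin (3 + 1) → ℤ) → ℝ}
  {lam : Fin (3 + 1) → Site (3 + 1) → Site (3 + 1) → ℝ} {G : Fin (3 + 1) → Site (3 + 1) → ℕ → Site (3 + 1) → ℝ}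
  {M M' : Fin (3 + 1) → (Fin (3 + 1) → ℤ) → Fin (3 + 1) → (Fin (3 + 1) → ℤ) → ℝ}

/-- NOT IN PRINT; OUR PROOF ATTEMPT of the V analogue of the count BORNSEC-PLAN v1.1 §0 (c) for ONE lineage, every letter a HYPOTHESIS with explicit constants.
**THE WEIGHTED CONTACT ENTRY OF ONE V LINEAGE** (`d = 3`, `2 ≤ Lc`, in-block root; birth level `i`, `n+1` levels up): legs `T_i = legChain (respStepBmSeq ρ Lc) i n` (dressed envelope
`K_E, κ_E`) and `B_i = respStep (Lc^i) (Lc^{i+n+1})` ((N1) raw letter `C₁, κ₁`), the route's bond gauge functions (staircase `gauge_eq_staircase`, pieces `abs_gaugePiece_le`), an fm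
multiplier leg `M` (summable in the packed slot) and an mf multiplier leg `M′` (bounded, summable), both under the TENT letter `T_b·((Lc^n)^7)⁻¹·e^{−δ_K‖quo (Lc^n) y − ·‖∞}` at the
packed sites `Lc•y`; table `V = cVH • vhSAt ρ`; weight `(cE·Lc^8)^{n+1}`, `|cE| ≤ Lc^4`.  THEN, with `κ = min δ_K κ₁`, for ALL `κ′ u′ x z a b`:
`|(cE·Lc^8)^{n+1}·((push₃ (−T_i) M T_i S − push₃ (−B_i) M B_i S) + (push₃ M′ T_i T_i S′ − push₃ M′ B_i B_i S′)) κ′u′ x z a b| ≤ |cVH|·C_fin·((n+1)·(Lc⁻¹)^{n+1})·e^{−(κ∕96)(|x−u′|₁ + |z−u′|₁)}`,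
`S = reslot inl inr V`, `S′ = reslot inr inl V`, `C_fin = 2·Lc^3·((Lc^4)⁻¹·(4·T_b·(e^{8κ})²·Cnt)·(C₁²·(Lc·(64 + 544Lc + 768Lc²)))·Zl 4 (κ∕16))` — (B2) ∕ (B3) on the `inl∕inl` block,
`isFF_push₃` on the others, leaf-02's `units_le ∕ polyS_le` for the powers and the polynomial. -/
theorem abs_weight_mul_comb_contact_v_le_three (hLc : 2 ≤ Lc) (hrt : rt ∈ box (3 + 1) Lc) (hcE : |cE| ≤ (Lc : ℝ) ^ 4)
    (hN1 : ∀ (m k : ℕ) (μ : Fin (3 + 1)) (z : Site (3 + 1)) (l'' : Fin (3 + 1)) (w' : Site (3 + 1)),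
      |respStep (d := 3) (Lc ^ m) (Lc ^ (m + k + 1)) μ z l'' w'| ≤
        C₁ * ((Lc : ℝ) ^ (5 * (k + 1)))⁻¹ * Real.exp (-(κ₁ * supNorm (quo (Lc ^ (k + 1)) w' - z))))
    (hκ₁ : 0 < κ₁) (hC₁ : 0 ≤ C₁)
    (hE : ∀ μ z l u, |T μ z l u| ≤ KE * Real.exp (-(κE * supNorm (quo (Lc ^ (n + 1)) u - z))))
    (hκE : 0 < κE)
    (hTB : T - respStep (d := 3) (Lc ^ i) (Lc ^ (i + n + 1)) = fun μ z l u => dz (lam μ z) l u)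
    (hA : 0 ≤ A)
    (hψ : ∀ (μ₀ : Fin (3 + 1)) (z₀ u : Site (3 + 1)), lam μ₀ z₀ u = ∑ s ∈ Finset.range (n + 1), G μ₀ z₀ s (blk (Lc ^ s) u))
    (hGA : ∀ (μ₀ : Fin (3 + 1)) (z₀ : Site (3 + 1)) (s : ℕ), s ≤ n → ∀ u : Site (3 + 1),
      |G μ₀ z₀ s (blk (Lc ^ s) u)| ≤ A * C₁ * ((Lc : ℝ) ^ (5 * (n + 1)))⁻¹ * (Lc : ℝ) ^ s * Real.exp (-(κ₁ * supNorm (quo (Lc ^ (n + 1)) u - z₀))))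
    (hMs : ∀ a b μ, Summable fun z => M a b μ z)
    (hMt : ∀ (a : Fin (3 + 1)) (b : Site (3 + 1)) (μ : Fin (3 + 1)) (y : Site (3 + 1)),
      |M a b μ ((Lc : ℤ) • y)| ≤ Tb * ((((Lc : ℝ) ^ n) ^ (2 * 3 + 1))⁻¹) * Real.exp (-(δK * supNorm (quo (Lc ^ n) y - b))))
    (hM'b : ∀ a b μ z, |M' a b μ z| ≤ CM') (hM's : ∀ a b μ, Summable fun z => M' a b μ z)
    (hM't : ∀ (a : Fin (3 + 1)) (b : Site (3 + 1)) (μ : Fin (3 + 1)) (y : Site (3 + 1)),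
      |M' a b μ ((Lc : ℤ) • y)| ≤ Tb * ((((Lc : ℝ) ^ n) ^ (2 * 3 + 1))⁻¹) * Real.exp (-(δK * supNorm (quo (Lc ^ n) y - b))))
    (hδK : 0 < δK) (hTb : 0 ≤ Tb)
    (κ' : Fin (3 + 1)) (u' x z : Site (3 + 1)) (a b : Fib 3) :
    |(cE * (Lc : ℝ) ^ (2 * (3 + 1))) ^ (n + 1) *
        ((push₃ (-T) M T
              (reslot Sum.inl Sum.inr fun κ u => cVH • symVhSAt (toSite rt) 3 Lc rfl κ u) κ' u' x z a b
            - push₃ (-respStep (d := 3) (Lc ^ i) (Lc ^ (i + n + 1))) M (respStep (d := 3) (Lc ^ i) (Lc ^ (i + n + 1)))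
              (reslot Sum.inl Sum.inr fun κ u => cVH • symVhSAt (toSite rt) 3 Lc rfl κ u) κ' u' x z a b)
          + (push₃ M' T T
              (reslot Sum.inr Sum.inl fun κ u => cVH • symVhSAt (toSite rt) 3 Lc rfl κ u) κ' u' x z a b
            - push₃ M' (respStep (d := 3) (Lc ^ i) (Lc ^ (i + n + 1))) (respStep (d := 3) (Lc ^ i) (Lc ^ (i + n + 1)))
              (reslot Sum.inr Sum.inl fun κ u => cVH • symVhSAt (toSite rt) 3 Lc rfl κ u) κ' u' x z a b))|
      ≤ |cVH| * (2 * ((Lc : ℝ) ^ 3 * (((((3 + 1).factorial : ℕ) : ℝ) * (Lc : ℝ) ^ (3 + 1))⁻¹ * (((3 : ℝ) + 1) * Tb * (Real.exp (2 * ((3 : ℝ) + 1) * min δK κ₁) ^ 2 *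
              (((2 * Lc : ℕ) : ℝ) ^ (3 + 1) * (((3 + 1 : ℕ) : ℝ) * ((((3 + 1).factorial : ℕ) : ℝ) * ((Lc : ℝ) ^ (3 + 1) * (ell (3 + 1) Lc : ℝ)))))))
            * (C₁ ^ 2 * (4 * A + 4 * A ^ 2 + 4 * A * Lc + 8 * A ^ 2 * Lc)) * Zl (3 + 1) (min δK κ₁ / (4 * ((3 : ℝ) + 1))))))
          * ((((n : ℝ) + 1)) * ((Lc : ℝ)⁻¹) ^ (n + 1))
          * Real.exp (-(min δK κ₁ / 12 / 2 / ((3 : ℝ) + 1)) * (l1 (x - u') + l1 (z - u'))) := by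
  -- abbreviations for an1's normalisation constants and the cell polynomial (atoms for `ring` ∕ `gcongr`)
  set Φ : ℝ := ((((3 + 1).factorial : ℕ) : ℝ) * (Lc : ℝ) ^ (3 + 1))⁻¹ with hΦdef
  set Cn : ℝ := (((2 * Lc : ℕ) : ℝ) ^ (3 + 1) * (((3 + 1 : ℕ) : ℝ) * ((((3 + 1).factorial : ℕ) : ℝ) * ((Lc : ℝ) ^ (3 + 1) * (ell (3 + 1) Lc : ℝ))))) with hCndef
  set Pn : ℝ := (4 * A + 4 * A ^ 2 + 4 * A * Lc + 8 * A ^ 2 * Lc) with hPndef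
  have hΦ0 : 0 ≤ Φ := by positivity
  have hCn0 : 0 ≤ Cn := by positivity
  have hPn0 : 0 ≤ Pn := by positivity
  have hLc1 : 1 ≤ Lc := le_trans (by norm_num) hLc
  have hL : (0 : ℝ) < (Lc : ℝ) := Nat.cast_pos.2 (Nat.pos_of_ne_zero (NeZero.ne Lc))
  have hLn1 : 1 ≤ Lc ^ (n + 1) := Nat.one_le_pow _ _ hLc1
  set κ : ℝ := min δK κ₁ with hκdef
  have hκ : 0 < κ := lt_min hδK hκ₁
  have hκK : κ ≤ δK := min_le_left _ _
  have hκ1 : κ ≤ κ₁ := min_le_right _ _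
  -- the field-slot letters at the common rate `κ`
  set B := respStep (d := 3) (Lc ^ i) (Lc ^ (i + n + 1)) with hBdef
  have hT : ∀ μ z' l u, |T μ z' l u| ≤ KE := abs_le_of_env' hκE.le hE
  have hTs : ∀ μ z' l, Summable fun u => T μ z' l u := summable_of_env' hLn1 hκE hE
  have hB : ∀ μ z' l u, |B μ z' l u| ≤ C₁ * ((Lc : ℝ) ^ (5 * (n + 1)))⁻¹ * Real.exp (-(κ * supNorm (quo (Lc ^ (n + 1)) u - z'))) := by
    intro μ z' l u
    exact (hN1 i n μ z' l u).trans (mul_le_mul_of_nonneg_left (exp_env_mono_rate hκ1 (supNorm_nonneg _)) (by positivity))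
  -- the gauge staircase pieces at the common rate `κ`
  have hG : ∀ (μ₀ : Fin (3 + 1)) (z₀ : Site (3 + 1)) (s : ℕ), s ≤ n → ∀ u : Site (3 + 1),
      |G μ₀ z₀ s (blk (Lc ^ s) u)| ≤ A * C₁ * ((Lc : ℝ) ^ (5 * (n + 1)))⁻¹ * (Lc : ℝ) ^ s * Real.exp (-(κ * supNorm (quo (Lc ^ (n + 1)) u - z₀))) := by
    intro μ₀ z₀ s hs u
    refine (hGA μ₀ z₀ s hs u).trans (mul_le_mul_of_nonneg_left (exp_env_mono_rate hκ1 (supNorm_nonneg _)) (by positivity))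
  -- the two tents at the common rate
  have hMt' : ∀ (a : Fin (3 + 1)) (b : Site (3 + 1)) (μ : Fin (3 + 1)) (y : Site (3 + 1)),
      |M a b μ ((Lc : ℤ) • y)| ≤ (Tb * ((((Lc : ℝ) ^ n) ^ (2 * 3 + 1))⁻¹)) * Real.exp (-(κ * supNorm (quo (Lc ^ n) y - b))) := fun a b μ y =>
    (hMt a b μ y).trans (mul_le_mul_of_nonneg_left (exp_env_mono_rate hκK (supNorm_nonneg _)) (by positivity))
  have hM't' : ∀ (a : Fin (3 + 1)) (b : Site (3 + 1)) (μ : Fin (3 + 1)) (y : Site (3 + 1)),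
      |M' a b μ ((Lc : ℤ) • y)| ≤ (Tb * ((((Lc : ℝ) ^ n) ^ (2 * 3 + 1))⁻¹)) * Real.exp (-(κ * supNorm (quo (Lc ^ n) y - b))) := fun a b μ y =>
    (hM't a b μ y).trans (mul_le_mul_of_nonneg_left (exp_env_mono_rate hκK (supNorm_nonneg _)) (by positivity))
  -- the scale `cVH` and the sign of the fm pushes out; entries
  simp only [push₃_reslot_smul, push₃_neg_left]
  simp only [Pi.smul_apply, Pi.neg_apply, smul_eq_mul]
  set P₁ := push₃ T M T (reslot Sum.inl Sum.inr (symVhSAt (toSite rt) 3 Lc rfl)) κ' u' with hP₁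
  set P₂ := push₃ B M B (reslot Sum.inl Sum.inr (symVhSAt (toSite rt) 3 Lc rfl)) κ' u' with hP₂
  set P₃ := push₃ M' T T (reslot Sum.inr Sum.inl (symVhSAt (toSite rt) 3 Lc rfl)) κ' u' with hP₃
  set P₄ := push₃ M' B B (reslot Sum.inr Sum.inl (symVhSAt (toSite rt) 3 Lc rfl)) κ' u' with hP₄
  have e : (cE * (Lc : ℝ) ^ (2 * (3 + 1))) ^ (n + 1) * (cVH * -P₁ x z a b - cVH * -P₂ x z a b + (cVH * P₃ x z a b - cVH * P₄ x z a b))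
      = ((cE * (Lc : ℝ) ^ (2 * (3 + 1))) ^ (n + 1) * cVH) * ((P₃ x z a b - P₄ x z a b) - (P₁ x z a b - P₂ x z a b)) := by ring
  rw [e, abs_mul, abs_mul, abs_pow]
  -- the tables are ff-valued
  have hS1 : Push4.IsFF P₁ := isFF_push₃ (l := T) (r := M) (w := T) (reslot Sum.inl Sum.inr (symVhSAt (toSite rt) 3 Lc rfl)) κ' u'
  have hS2 : Push4.IsFF P₂ := isFF_push₃ (l := B) (r := M) (w := B) (reslot Sum.inl Sum.inr (symVhSAt (toSite rt) 3 Lc rfl)) κ' u'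
  have hS3 : Push4.IsFF P₃ := isFF_push₃ (l := M') (r := T) (w := T) (reslot Sum.inr Sum.inl (symVhSAt (toSite rt) 3 Lc rfl)) κ' u'
  have hS4 : Push4.IsFF P₄ := isFF_push₃ (l := M') (r := B) (w := B) (reslot Sum.inr Sum.inl (symVhSAt (toSite rt) 3 Lc rfl)) κ' u'
  have hZ : 0 ≤ Zl (3 + 1) (κ / (4 * ((3 : ℝ) + 1))) := Zl_nonneg (by positivity)
  have hRHS0 : 0 ≤ |cVH| * (2 * ((Lc : ℝ) ^ 3 * (Φ * (((3 : ℝ) + 1) * Tb * (Real.exp (2 * ((3 : ℝ) + 1) * κ) ^ 2 *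
              Cn))
            * (C₁ ^ 2 * Pn) * Zl (3 + 1) (κ / (4 * ((3 : ℝ) + 1))))))
          * ((((n : ℝ) + 1)) * ((Lc : ℝ)⁻¹) ^ (n + 1))
          * Real.exp (-(κ / 12 / 2 / ((3 : ℝ) + 1)) * (l1 (x - u') + l1 (z - u'))) := by positivity
  rcases a with α | μa
  · rcases b with β | νb
    · -- the cells: (B2) on the fm pair, (B3) on the mf pair
      have hfm := abs_contact_border_fm_le (d := 3) (Lc := Lc) (rr := rt) (n := n)
        (αg := A * C₁ * ((Lc : ℝ) ^ (5 * (n + 1)))⁻¹) (KB := C₁ * ((Lc : ℝ) ^ (5 * (n + 1)))⁻¹)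
        (Tb := Tb * ((((Lc : ℝ) ^ n) ^ (2 * 3 + 1))⁻¹)) (lam := lam) (G := G) hLc1 hrt hκ (by positivity) (by positivity) (by positivity)
        hT hTs hB hTB hψ hG hMs hMt' κ' u' x z α β
      have hmf := abs_contact_border_mf_le (d := 3) (Lc := Lc) (rr := rt) (n := n)
        (αg := A * C₁ * ((Lc : ℝ) ^ (5 * (n + 1)))⁻¹) (KB := C₁ * ((Lc : ℝ) ^ (5 * (n + 1)))⁻¹)
        (Tb := Tb * ((((Lc : ℝ) ^ n) ^ (2 * 3 + 1))⁻¹)) (lam := lam) (G := G) hLc1 hrt hκ (by positivity) (by positivity) (by positivity)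
        hT hTs hB hTB hψ hG hM'b hM's hM't' κ' u' x z α β
      -- |mf − fm| ≤ |mf| + |fm|
      refine (mul_le_mul_of_nonneg_left ((abs_sub _ _).trans (add_le_add hmf hfm)) (by positivity)).trans ?_
      -- the polynomial against leaf-02's, the envelopes re-centred at `u′` in `ℓ¹` currency
      have hX : (0 : ℝ) < (Lc : ℝ) ^ (5 * (n + 1)) := by positivity
      have hPoly : 2 * (C₁ * ((Lc : ℝ) ^ (5 * (n + 1)))⁻¹) * (2 * (A * C₁ * ((Lc : ℝ) ^ (5 * (n + 1)))⁻¹) + 2 * (A * C₁ * ((Lc : ℝ) ^ (5 * (n + 1)))⁻¹) * Lc * n)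
            + (4 * (A * C₁ * ((Lc : ℝ) ^ (5 * (n + 1)))⁻¹) ^ 2 + 2 * (4 * (A * C₁ * ((Lc : ℝ) ^ (5 * (n + 1)))⁻¹) ^ 2) * Lc * n)
          ≤ C₁ ^ 2 * (((Lc : ℝ) ^ (5 * (n + 1)))⁻¹) ^ 2 * (((n : ℝ) + 1) * Pn) :=
        polyV_le (Lc := Lc) hX hA n
      have hEXz : Real.exp (-(κ / 12) * (supNorm (x - z) + supNorm (u' - z)))
          ≤ Real.exp (-(κ / 12 / 2 / ((3 : ℝ) + 1)) * (l1 (x - u') + l1 (z - u'))) :=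
        (exp_recenter_right_le (c := κ / 12) (by positivity) x z u').trans
          (exp_supNorm_add_le_exp_l1 (d := 3) (c := κ / 12 / 2) (by positivity) (x - u') (z - u'))
      have hEXx : Real.exp (-(κ / 12) * (supNorm (z - x) + supNorm (u' - x)))
          ≤ Real.exp (-(κ / 12 / 2 / ((3 : ℝ) + 1)) * (l1 (x - u') + l1 (z - u'))) :=
        (exp_recenter_left_le (c := κ / 12) (by positivity) x z u').trans
          (exp_supNorm_add_le_exp_l1 (d := 3) (c := κ / 12 / 2) (by positivity) (x - u') (z - u'))
      -- each cell bound ≤ the same cell bound with leaf-02's polynomial and the re-centred envelope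
      have key : ∀ {EX : ℝ}, 0 ≤ EX → EX ≤ Real.exp (-(κ / 12 / 2 / ((3 : ℝ) + 1)) * (l1 (x - u') + l1 (z - u'))) →
          Φ *
              ((((3 : ℝ) + 1) * (Tb * ((((Lc : ℝ) ^ n) ^ (2 * 3 + 1))⁻¹)) * (Real.exp (2 * ((3 : ℝ) + 1) * κ) ^ 2 *
                  Cn))
                * (2 * (C₁ * ((Lc : ℝ) ^ (5 * (n + 1)))⁻¹) * (2 * (A * C₁ * ((Lc : ℝ) ^ (5 * (n + 1)))⁻¹)
                      + 2 * (A * C₁ * ((Lc : ℝ) ^ (5 * (n + 1)))⁻¹) * Lc * n)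
                    + (4 * (A * C₁ * ((Lc : ℝ) ^ (5 * (n + 1)))⁻¹) ^ 2
                      + 2 * (4 * (A * C₁ * ((Lc : ℝ) ^ (5 * (n + 1)))⁻¹) ^ 2) * Lc * n))
                * ((((Lc ^ n : ℕ) : ℝ)) ^ (3 + 1) * Zl (3 + 1) (κ / (4 * ((3 : ℝ) + 1))))
                * EX)
            ≤ Φ *
              ((((3 : ℝ) + 1) * (Tb * ((((Lc : ℝ) ^ n) ^ (2 * 3 + 1))⁻¹)) * (Real.exp (2 * ((3 : ℝ) + 1) * κ) ^ 2 *
                  Cn))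
                * (C₁ ^ 2 * (((Lc : ℝ) ^ (5 * (n + 1)))⁻¹) ^ 2 * (((n : ℝ) + 1) * Pn))
                * ((((Lc ^ n : ℕ) : ℝ)) ^ (3 + 1) * Zl (3 + 1) (κ / (4 * ((3 : ℝ) + 1))))
                * Real.exp (-(κ / 12 / 2 / ((3 : ℝ) + 1)) * (l1 (x - u') + l1 (z - u')))) := by
        intro EX hEX0 hEX
        gcongr
      refine (mul_le_mul_of_nonneg_left (add_le_add (key (Real.exp_pos _).le hEXx) (key (Real.exp_pos _).le hEXz)) (by positivity)).trans ?_
      -- the powers: `units_le`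
      have hU := units_le (Lc := Lc) hcE n
      have hR0 : 0 ≤ |cVH| * (2 * (Φ * (((3 : ℝ) + 1) * Tb * (Real.exp (2 * ((3 : ℝ) + 1) * κ) ^ 2 *
              Cn))
            * (C₁ ^ 2 * Pn) * Zl (3 + 1) (κ / (4 * ((3 : ℝ) + 1)))))
          * (((n : ℝ) + 1)) * Real.exp (-(κ / 12 / 2 / ((3 : ℝ) + 1)) * (l1 (x - u') + l1 (z - u'))) := by positivity
      calc |cE * (Lc : ℝ) ^ (2 * (3 + 1))| ^ (n + 1) * |cVH| *
            (Φ *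
              ((((3 : ℝ) + 1) * (Tb * ((((Lc : ℝ) ^ n) ^ (2 * 3 + 1))⁻¹)) * (Real.exp (2 * ((3 : ℝ) + 1) * κ) ^ 2 *
                  Cn))
                * (C₁ ^ 2 * (((Lc : ℝ) ^ (5 * (n + 1)))⁻¹) ^ 2 * (((n : ℝ) + 1) * Pn))
                * ((((Lc ^ n : ℕ) : ℝ)) ^ (3 + 1) * Zl (3 + 1) (κ / (4 * ((3 : ℝ) + 1))))
                * Real.exp (-(κ / 12 / 2 / ((3 : ℝ) + 1)) * (l1 (x - u') + l1 (z - u'))))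
            + Φ *
              ((((3 : ℝ) + 1) * (Tb * ((((Lc : ℝ) ^ n) ^ (2 * 3 + 1))⁻¹)) * (Real.exp (2 * ((3 : ℝ) + 1) * κ) ^ 2 *
                  Cn))
                * (C₁ ^ 2 * (((Lc : ℝ) ^ (5 * (n + 1)))⁻¹) ^ 2 * (((n : ℝ) + 1) * Pn))
                * ((((Lc ^ n : ℕ) : ℝ)) ^ (3 + 1) * Zl (3 + 1) (κ / (4 * ((3 : ℝ) + 1))))
                * Real.exp (-(κ / 12 / 2 / ((3 : ℝ) + 1)) * (l1 (x - u') + l1 (z - u')))))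
          = (|cE * (Lc : ℝ) ^ (2 * (3 + 1))| ^ (n + 1) *
              (((((Lc : ℝ) ^ n) ^ (2 * 3 + 1))⁻¹ * ((((Lc : ℝ) ^ (5 * (n + 1)))⁻¹) ^ 2 * (((Lc ^ n : ℕ) : ℝ)) ^ (3 + 1)))))
            * (|cVH| * (2 * (Φ * (((3 : ℝ) + 1) * Tb * (Real.exp (2 * ((3 : ℝ) + 1) * κ) ^ 2 *
                Cn))
              * (C₁ ^ 2 * Pn) * Zl (3 + 1) (κ / (4 * ((3 : ℝ) + 1)))))
              * (((n : ℝ) + 1)) * Real.exp (-(κ / 12 / 2 / ((3 : ℝ) + 1)) * (l1 (x - u') + l1 (z - u')))) := by ring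
        _ ≤ ((Lc : ℝ) ^ 3 * ((Lc : ℝ)⁻¹) ^ (n + 1))
            * (|cVH| * (2 * (Φ * (((3 : ℝ) + 1) * Tb * (Real.exp (2 * ((3 : ℝ) + 1) * κ) ^ 2 *
                Cn))
              * (C₁ ^ 2 * Pn) * Zl (3 + 1) (κ / (4 * ((3 : ℝ) + 1)))))
              * (((n : ℝ) + 1)) * Real.exp (-(κ / 12 / 2 / ((3 : ℝ) + 1)) * (l1 (x - u') + l1 (z - u')))) :=
          mul_le_mul_of_nonneg_right hU hR0
        _ = _ := by ring
    · -- `b = inr`: every push is ff-valued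
      rw [hS1.2 x z (Sum.inl α) νb, hS2.2 x z (Sum.inl α) νb, hS3.2 x z (Sum.inl α) νb, hS4.2 x z (Sum.inl α) νb]
      simp only [sub_self, abs_zero, mul_zero]
      exact hRHS0
  · rw [hS1.1 x z μa b, hS2.1 x z μa b, hS3.1 x z μa b, hS4.1 x z μa b]
    simp only [sub_self, abs_zero, mul_zero]
    exact hRHS0

end Lineage

end Summit.QuantumFields.BalabanUV.Beta.GAN24.CombBornBorderContactLineage

end
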